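import Summits.QuantumFields.BalabanUV.T4Continuum.Support.B13DomainGeometryTR
import Summits.QuantumFields.BalabanUV.T4Continuum.Support.NE9MarginalProjectionEnd

/-!
# NE9 (node U3, history side) — crew row (w13) part 3 ∕ sibling of (w12): the END faces of row NE9 ON THE CARRIERS OF RECORD
with the geometry leaves L-G1∕L-G2 discharged IN THE PRINTED CURRENCY `d_j = torusTreeLen` (ADDITIVE room), through NE5-P2's
tree-length geometry `B13DomainGeometryTR`

Cell `pub-balaban`, T⁴ programme, row NE9; unit `b2b-balaban-t4-ne9-formalise-leaf-05-g2` (NE9 formalisation swarm LEAF PROVER 05,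
gen 2; OFFER∕CLAIM CLAIMS.log l.7073).  Row (w12) (`Spine/NE9/CarriersOfRecordFaces`, unit `…-leaf-02-g2`) typed END-B∕V∕S on the
carriers of record `B13Carriers.TwoRuns.carriers` with the geometry leaves discharged by road P2's CUBE-COUNT producers
(`CubeChart.decayExtract∕pinBudget`: `δ X = d₁·#cubes X`, `κ ≤ d₁`, envelope `a₁`) and carries the rider of the census finding
F-ne9leaf01-1 (rate division κ < a′∕2^ν, e^{a+a′} in the fading product).  On the SAME carriers the printed-currency dischargers
ALREADY EXIST — for the geometry of NE5's cluster representation of record, `ClusterGeom.ofRep (B13DomainGeometryTR.clusterRep R ρA ρB)`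
(polymers = Bałaban's localization domains `Σ_j 𝐃_j`, incompatibility = footprints sharing a cube or a wall, step volume of `X` =
`𝐃_{scale X}`, pin = `X` itself): `B13DomainGeometryTR.decayExtract_b13` (G1 from (2.27) `ineq227_level`, printed constant 5),
`pinBudget_b13` (G2 from (2.30) `volBound_level`, envelope `τ·64·e^{−5σ}` for `κ + 1 ≤ σ`) — cross-row probe C-ne9leaf09-2 of
`…-leaf-09`.  THIS FILE is the two-line composition that puts them under the row's END faces BY NAME:

* `recTR_ne9_and_fadingMemory_of_couplingTwoPoint` — END-B `NE9LastCouplingBridge.ne9_and_fadingMemory_of_couplingTwoPoint` at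
  `C := R.carriers`, `G := ClusterGeom.ofRep (clusterRep R ρA ρB)`, KP size function `a := fun Z => τ·#footprint Z`, decay weights
  `d := fun Z => σ·d(Z) + σ·5`, extracted decay `δ := fun X => σ·(d(X) + 5)`, pin budget `B := τ·64·e^{−5σ}`; the binders
  `hdec hpin hB` are REPLACED by `hτ : 0 ≤ τ`, `hσ : 0 ≤ σ`, `hσκ : κ + 1 ≤ σ` — ADDITIVE in κ (no 2^ν); the envelope entering the fading
  rate `ω + 4·lipbar·B·τ̄` carries `e^{−5σ}` (print's e^{5κ} of p.18∕p.21 sits on the KP side, `kpInflated_b13`'s smallness);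
* `recTR_termSize_ne9_and_fadingMemory_of_couplingTwoPoint_vacSub_sizeInduction` — the occupation-free END-S-vac
  `NE9BridgeSizeInduction.…_vacSub_sizeInduction` likewise (`hNsucc : p₀ j + 2·B ≤ N (j+1)` with the same `B`);
* `recTR_…_vacSub_sizeInduction_compProj` ∕ `…_margProj` — the owner's repaired faces `NE9MarginalProjectionEnd.…_compProj` ∕
  `…_margProj` (O-ne9p1g22-1: channel `𝒯 ∘ P` on the marginal-free class) likewise, rate `ω + 8·lipbar·B·((1+c)·τ̄)`;
* `twoPointKP_of_kpInflated` — NE5-P2's `KPInflated … 1 a d` (the conclusion shape of the d-currency producer `kpInflated_b13`) + the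
  two activity clauses ⇒ `TwoPointKP` on `ClusterGeom.ofRep (clusterRep R ρA ρB)` (A1's KP conjunct in the printed currency).

Every other binder is the END's, verbatim (L-O1 model objects, L-S1…S5, L-A1 `hK : TwoPointKP …` — whose KP clause has the
d-currency producer `B13DomainGeometryTR.kpInflated_b13` with ADDITIVE room `64·log 162 + σ + 64τ ≤ R`, NOT applied here: the
(2.38)-shaped majorant is NODE O's —, L-A2, L-A3, L-A4, L-R1, L-R2 ∕ (B0)(XZ)(N′)(R′), L-N1).  `ρA ρB` (NE5's activity rows) only
index the representation; the geometry does not depend on them.  0 `def`, 0 `[cite:` fact, nothing re-wired; (w12)'s cube-currency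
faces stay as they are (both currencies now typed on the carriers of record).

HONEST FRAMING: bookkeeping for rung (B)+1 on a FIXED finite four-torus; «NE9 ⇐ the named binders: geometry leaves L-G1∕L-G2 inhabited
on `B13Carriers.TwoRuns.carriers` in the printed currency d_j»; the analytic leaves (A1–A3, S5) and the model O1 are untouched;
NE9 is NOT PRINTED and NOT PROVED; spine PROVED 0∕9; NOT infinite volume, NOT a mass gap, NOT Clay.  HONEST DEPENDENCY: continuum YM
on T⁴ ⇐ BetaPertH ∧ nine spine estimates (0/9 proved); BetaPertH ⇐ (D1) ∧ (D4) ∧ CAP+tail; G-an2-4 gates asym, D1 and NE2/3/4.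

References (TYPES∕STRUCTURE only): [I] = [Balaban1987RG1] p.257 (domains, d_j), (1.18) p.263, (2.12)–(2.14) p.268;
[II] = [Balaban1988RG2Cluster] (1.26) p.8, (2.13) p.14, (2.27), (2.30) p.18, Lemma 3 (2.38) p.20, (2.40)–(2.41) p.21;
[KoteckyPreiss1986] (1)–(3).
-/

noncomputable section

namespace Summit.QuantumFields.BalabanUV.T4Continuum.NE9.CarriersOfRecordFacesTR

open scoped BigOperators
open Literature.MathematicalPhysics.QuantumFieldTheory.Balaban1983to89
open Literature.MathematicalPhysics.QuantumFieldTheory.Balaban1983to89.T4OutputRate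
open Literature.MathematicalPhysics.QuantumFieldTheory.Balaban1983to89.T4HistoryLipschitzRecursion
open Literature.MathematicalPhysics.QuantumFieldTheory.Balaban1983to89.T4HistoryLipschitzOuter
open Literature.MathematicalPhysics.QuantumFieldTheory.Balaban1983to89.T4HistoryLipschitzActivity
open Literature.MathematicalPhysics.QuantumFieldTheory.Balaban1983to89.T4HistoryLipschitzActivity (ClusterGeom)
open Literature.MathematicalPhysics.QuantumFieldTheory.Balaban1983to89.T4HistoryLipschitzSegment
open Summit.QuantumFields.BalabanUV.T4Continuum.NE9LastCouplingBridge
open Summit.QuantumFields.BalabanUV.T4Continuum.NE9BridgeSizeInduction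
open Summit.QuantumFields.BalabanUV.T4Continuum.NE9MarginalProjection
open Summit.QuantumFields.BalabanUV.T4Continuum.NE9MarginalProjectionEnd
open Summit.QuantumFields.BalabanUV.T4Continuum.B13Carriers (TwoRuns)
open Summit.QuantumFields.BalabanUV.T4Continuum.B13DomainGeometryTR (footprint clusterRep decayExtract_b13 pinBudget_b13)

variable {Gg : Type} [GaugeGroup Gg] (R : TwoRuns Gg) {Bg : Type} {Pot : Type*} [NormedAddCommGroup Pot] [NormedSpace ℂ Pot]

/-- **END-B ON THE CARRIERS OF RECORD, GEOMETRY LEAVES IN THE PRINTED CURRENCY d_j (kernel; bookkeeping).**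
`NE9LastCouplingBridge.ne9_and_fadingMemory_of_couplingTwoPoint` at `C := R.carriers`, `G := ClusterGeom.ofRep (clusterRep R ρA ρB)`,
`a := fun Z => τ·#footprint Z`, `d := fun Z => σ·d Z + σ·5`, `δ := fun X => σ·(d X + 5)`, `B := τ·64·e^{−5σ}`; L-G1 ⇐
`B13DomainGeometryTR.decayExtract_b13` ((2.27)), L-G2 ⇐ `pinBudget_b13` ((2.30), `κ + 1 ≤ σ`).  Conclusion: the root shape with
`ℓ = 4·clipbar·B + pexbar + 4·lipbar·B·qTbar`, `ω′ = ω + 4·lipbar·B·τbar`, `B = τ·64·e^{−5σ}`. [folklore] -/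
theorem recTR_ne9_and_fadingMemory_of_couplingTwoPoint {ι : Type} {E : Functional R.carriers Bg}
    (ρA ρB : (ℕ → ℝ) → R.carriers.BgB → R.carriers.Dom → ℂ)
    {W : Set (ℕ → ℝ)} {Adm : Set (Bg → R.carriers.Dom → ℝ)} {T : ℕ → (ℕ → ℝ) → (Bg → R.carriers.Dom → ℝ) → ι → ℝ}
    {Ψ : ℕ → ℝ → (ι → ℝ) → Bg → R.carriers.Dom → ℝ}
    {act : ℕ → ℝ → Bg → Pot → (ClusterGeom.ofRep (clusterRep R ρA ρB)).P → ℂ} {𝒜 : ℕ → Set Pot}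
    {n : ℕ → ℝ → Bg → (ClusterGeom.ofRep (clusterRep R ρA ρB)).P → ℝ} {lip clip : ℕ → ℝ}
    {κ τ σ lipbar clipbar pexbar qTbar τbar ω : ℝ} {wt : ℕ → ι → ℝ} {τm : ℕ → ℕ → ℝ} {pex qT : ℕ → ℝ}
    (ρ : ℕ → (ι → ℝ) → Pot) (expl : ℕ → ℝ → Bg → R.carriers.Dom → ℝ)
    -- L-S1 … L-S4
    (h0 : ScaleZeroFree E W) (hAdm : AdmissibleTerms E W Adm) (hres : AdmRestrict Adm) (hadd : ChannelAdditive Adm T)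
    (hsum : ChannelStepSum Adm T) (hfac : Factorises E W T Ψ)
    (hrepr : ∀ (k : ℕ) (s : ℝ) (P : ι → ℝ) (U : Bg) (X : R.carriers.Dom),
      Ψ k s P U X = ((ClusterGeom.ofRep (clusterRep R ρA ρB)).newTerm act k s U X (ρ k P)).re + expl k s U X)
    -- L-S5 (displayed, c3)
    (hstep : ChannelSizeAtStepNN Adm T κ wt τm)
    (hτm : ∀ k j, j ≤ k → 0 ≤ τm k j ∧ τm k j ≤ τbar * ω ^ (k - j))
    -- L-A1 (the KP clause has the d-currency producer `B13DomainGeometryTR.kpInflated_b13`; displayed here)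
    (hK : TwoPointKP (ClusterGeom.ofRep (clusterRep R ρA ρB)) W act 𝒜 n lip
      (fun Z => τ * ((footprint Z).card : ℝ)) (fun Z => σ * R.carriers.d Z + σ * 5))
    (hlipb : ∀ k, lip k ≤ lipbar)
    -- L-A2
    (hclip0 : ∀ k, 0 ≤ clip k)
    (hCup : ∀ g ∈ W, ∀ g' ∈ W, ∀ (k : ℕ) (U : Bg) (X : R.carriers.Dom), R.carriers.scale X = k + 1 → ∀ Q ∈ 𝒜 k,
      ∀ γ ∈ (ClusterGeom.ofRep (clusterRep R ρA ρB)).vol X,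
        ‖act k (g k) U Q γ‖ ≤ n k (g' k) U γ ∧
          ‖act k (g k) U Q γ - act k (g' k) U Q γ‖ ≤ clip k * |g k - g' k| * n k (g' k) U γ)
    (hclipb : ∀ k, clip k ≤ clipbar)
    -- L-A3
    (hqT0 : ∀ k, 0 ≤ qT k)
    (hTcup : ∀ g ∈ W, ∀ g' ∈ W, ∀ (k : ℕ) (y : ι), |T k g (E g) y - T k g' (E g) y| ≤ wt k y * (qT k * |g k - g' k|))
    (hqTb : ∀ k, qT k ≤ qTbar)
    -- L-A4
    (hexpl : ∀ g ∈ W, ∀ g' ∈ W, ∀ (k : ℕ) (U : Bg) (X : R.carriers.Dom), R.carriers.scale X = k + 1 →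
      |expl k (g k) U X - expl k (g' k) U X| ≤ Real.exp (-(κ * R.carriers.d X)) * (pex k * |g k - g' k|))
    (hpexb : ∀ k, pex k ≤ pexbar) (hpexbar : 0 ≤ pexbar)
    -- L-G1, L-G2 DISCHARGED in the printed currency: three scalars
    (hτ : 0 ≤ τ) (hσ : 0 ≤ σ) (hσκ : κ + 1 ≤ σ)
    -- L-R1
    (hρ : ∀ (k : ℕ) (P P' : ι → ℝ) (M : ℝ), (∀ y, |P y - P' y| ≤ wt k y * M) → ‖ρ k P - ρ k P'‖ ≤ M)
    -- L-R2
    (hocc : ∀ g ∈ W, ∀ g' ∈ W, ∀ k : ℕ, ρ k (T k g' (E g)) ∈ 𝒜 k)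
    -- L-N1
    (hτbar : 0 ≤ τbar) (hω : 0 ≤ ω) (hpos : 0 < ω + 4 * lipbar * (τ * 64 * Real.exp (-(σ * 5))) * τbar) :
    NE9 E W κ (prodModuli (4 * clipbar * (τ * 64 * Real.exp (-(σ * 5))) + pexbar +
        4 * lipbar * (τ * 64 * Real.exp (-(σ * 5))) * qTbar)
      fun _ => ω + 4 * lipbar * (τ * 64 * Real.exp (-(σ * 5))) * τbar) ∧
      FadingMemory ((4 * clipbar * (τ * 64 * Real.exp (-(σ * 5))) + pexbar +
          4 * lipbar * (τ * 64 * Real.exp (-(σ * 5))) * qTbar) / (ω + 4 * lipbar * (τ * 64 * Real.exp (-(σ * 5))) * τbar))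
        (ω + 4 * lipbar * (τ * 64 * Real.exp (-(σ * 5))) * τbar)
        (prodModuli (4 * clipbar * (τ * 64 * Real.exp (-(σ * 5))) + pexbar +
            4 * lipbar * (τ * 64 * Real.exp (-(σ * 5))) * qTbar)
          fun _ => ω + 4 * lipbar * (τ * 64 * Real.exp (-(σ * 5))) * τbar) :=
  ne9_and_fadingMemory_of_couplingTwoPoint (ClusterGeom.ofRep (clusterRep R ρA ρB)) ρ expl h0 hAdm hres hadd hsum hstep hfac
    hclip0 hCup hqT0 hTcup hrepr hexpl hclipb hpexb hpexbar hqTb hK (fun X K hK' => decayExtract_b13 ρA ρB hσ X K hK')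
    (fun _ X _ => pinBudget_b13 ρA ρB hτ hσκ X) hρ hocc (by positivity) hlipb hτbar hω hpos hτm

/-- **END-S-vac ON THE CARRIERS OF RECORD, GEOMETRY LEAVES IN THE PRINTED CURRENCY d_j (kernel; bookkeeping).**
`NE9BridgeSizeInduction.ne9_and_fadingMemory_of_couplingTwoPoint_vacSub_sizeInduction` (vacuum-subtracted representation, occupation
DERIVED from the one-run sizes (B0)∕(XZ)∕(N′)∕(R′)) at the same `C`, `G`, `a`, `d`, `δ`, `B := τ·64·e^{−5σ}`; constants 8;
`hNsucc : p₀ j + 2·B ≤ N (j+1)`.  After this theorem the carriers-of-record END displays NEITHER a geometry hypothesis NOR an explicit-part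
modulus NOR an occupation hypothesis, and its geometry is read in the printed currency. [folklore] -/
theorem recTR_termSize_ne9_and_fadingMemory_of_couplingTwoPoint_vacSub_sizeInduction {ι : Type} {E : Functional R.carriers Bg}
    (ρA ρB : (ℕ → ℝ) → R.carriers.BgB → R.carriers.Dom → ℂ)
    {W : Set (ℕ → ℝ)} {Adm : Set (Bg → R.carriers.Dom → ℝ)} {T : ℕ → (ℕ → ℝ) → (Bg → R.carriers.Dom → ℝ) → ι → ℝ}
    {Ψ : ℕ → ℝ → (ι → ℝ) → Bg → R.carriers.Dom → ℝ}
    {act : ℕ → ℝ → Bg → Pot → (ClusterGeom.ofRep (clusterRep R ρA ρB)).P → ℂ} {𝒜 : ℕ → Set Pot}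
    {n : ℕ → ℝ → Bg → (ClusterGeom.ofRep (clusterRep R ρA ρB)).P → ℝ} {lip clip : ℕ → ℝ}
    {κ τ σ lipbar clipbar qTbar τbar ω : ℝ} {wt : ℕ → ι → ℝ} {τm : ℕ → ℕ → ℝ} {qT p₀ N : ℕ → ℝ}
    (ρ : ℕ → (ι → ℝ) → Pot) (U₀ : Bg) (explZ : ℕ → Bg → R.carriers.Dom → ℝ)
    -- L-S1 … L-S4 (vacuum-subtracted representation)
    (h0 : ScaleZeroFree E W) (hAdm : AdmissibleTerms E W Adm) (hres : AdmRestrict Adm) (hadd : ChannelAdditive Adm T)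
    (hsum : ChannelStepSum Adm T) (hfac : Factorises E W T Ψ)
    (hreprV : ∀ (k : ℕ) (s : ℝ) (P : ι → ℝ) (U : Bg) (X : R.carriers.Dom),
      Ψ k s P U X = ((ClusterGeom.ofRep (clusterRep R ρA ρB)).newTerm act k s U X (ρ k P)).re -
        ((ClusterGeom.ofRep (clusterRep R ρA ρB)).newTerm act k s U₀ X (ρ k P)).re + explZ k U X)
    -- L-S5 (displayed, c3)
    (hstep : ChannelSizeAtStepNN Adm T κ wt τm)
    (hτm : ∀ k j, j ≤ k → 0 ≤ τm k j ∧ τm k j ≤ τbar * ω ^ (k - j))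
    -- L-A1
    (hK : TwoPointKP (ClusterGeom.ofRep (clusterRep R ρA ρB)) W act 𝒜 n lip
      (fun Z => τ * ((footprint Z).card : ℝ)) (fun Z => σ * R.carriers.d Z + σ * 5))
    (hlipb : ∀ k, lip k ≤ lipbar)
    -- L-A2
    (hclip0 : ∀ k, 0 ≤ clip k)
    (hCup : ∀ g ∈ W, ∀ g' ∈ W, ∀ (k : ℕ) (U : Bg) (X : R.carriers.Dom), R.carriers.scale X = k + 1 → ∀ Q ∈ 𝒜 k,
      ∀ γ ∈ (ClusterGeom.ofRep (clusterRep R ρA ρB)).vol X,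
        ‖act k (g k) U Q γ‖ ≤ n k (g' k) U γ ∧
          ‖act k (g k) U Q γ - act k (g' k) U Q γ‖ ≤ clip k * |g k - g' k| * n k (g' k) U γ)
    (hclipb : ∀ k, clip k ≤ clipbar)
    -- L-A3
    (hqT0 : ∀ k, 0 ≤ qT k)
    (hTcup : ∀ g ∈ W, ∀ g' ∈ W, ∀ (k : ℕ) (y : ι), |T k g (E g) y - T k g' (E g) y| ≤ wt k y * (qT k * |g k - g' k|))
    (hqTb : ∀ k, qT k ≤ qTbar)
    -- L-G1, L-G2 DISCHARGED in the printed currency: three scalars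
    (hτ : 0 ≤ τ) (hσ : 0 ≤ σ) (hσκ : κ + 1 ≤ σ)
    -- L-R1
    (hρ : ∀ (k : ℕ) (P P' : ι → ℝ) (M : ℝ), (∀ y, |P y - P' y| ≤ wt k y * M) → ‖ρ k P - ρ k P'‖ ≤ M)
    -- (B0), (XZ), (N′), (R′) in place of L-R2
    (hexplZ : ∀ (k : ℕ) (U : Bg) (X : R.carriers.Dom), R.carriers.scale X = k + 1 →
      |explZ k U X| ≤ Real.exp (-(κ * R.carriers.d X)) * p₀ k)
    (hbase : ∀ g ∈ W, ∀ (U : Bg) (X : R.carriers.Dom), R.carriers.scale X = 0 →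
      |E g U X| ≤ Real.exp (-(κ * R.carriers.d X)) * N 0)
    (hNsucc : ∀ j, p₀ j + 2 * (τ * 64 * Real.exp (-(σ * 5))) ≤ N (j + 1)) (hNnn : ∀ j, 0 ≤ N j)
    (hbox : ∀ (k : ℕ) (P : ι → ℝ), (∀ y, |P y| ≤ wt k y * sizeRadius τm N k) → ρ k P ∈ 𝒜 k)
    -- L-N1
    (hτbar : 0 ≤ τbar) (hω : 0 ≤ ω) (hpos : 0 < ω + 8 * lipbar * (τ * 64 * Real.exp (-(σ * 5))) * τbar) :
    TermSize E W κ N ∧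
      NE9 E W κ (prodModuli (8 * clipbar * (τ * 64 * Real.exp (-(σ * 5))) +
          8 * lipbar * (τ * 64 * Real.exp (-(σ * 5))) * qTbar)
        fun _ => ω + 8 * lipbar * (τ * 64 * Real.exp (-(σ * 5))) * τbar) ∧
        FadingMemory ((8 * clipbar * (τ * 64 * Real.exp (-(σ * 5))) + 8 * lipbar * (τ * 64 * Real.exp (-(σ * 5))) * qTbar) /
            (ω + 8 * lipbar * (τ * 64 * Real.exp (-(σ * 5))) * τbar))
          (ω + 8 * lipbar * (τ * 64 * Real.exp (-(σ * 5))) * τbar)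
          (prodModuli (8 * clipbar * (τ * 64 * Real.exp (-(σ * 5))) + 8 * lipbar * (τ * 64 * Real.exp (-(σ * 5))) * qTbar)
            fun _ => ω + 8 * lipbar * (τ * 64 * Real.exp (-(σ * 5))) * τbar) :=
  ne9_and_fadingMemory_of_couplingTwoPoint_vacSub_sizeInduction (ClusterGeom.ofRep (clusterRep R ρA ρB)) ρ U₀ explZ h0 hAdm
    hres hadd hsum hstep hfac hclip0 hCup hqT0 hTcup hreprV hclipb hqTb hK (fun X K hK' => decayExtract_b13 ρA ρB hσ X K hK')
    (fun _ X _ => pinBudget_b13 ρA ρB hτ hσκ X) hρ hexplZ hbase hNsucc hNnn hbox (by positivity) hlipb hτbar hω hpos hτm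

/-- **THE OWNER's REPAIRED FACE (O-ne9p1g22-1: channel `T := 𝒯 ∘ P`, S3∕S5 on the marginal-free class) ON THE CARRIERS OF
RECORD, GEOMETRY LEAVES IN THE PRINTED CURRENCY d_j (kernel; bookkeeping).**
`NE9MarginalProjectionEnd.ne9_and_fadingMemory_of_couplingTwoPoint_vacSub_sizeInduction_compProj` at the same `C`, `G`, `a`, `d`, `δ`,
`B := τ·64·e^{−5σ}`; rate `ω + 8·lipbar·B·((1 + c)·τ̄)`.  (The read-out form `…_margProj` composes identically.) [folklore] -/
theorem recTR_termSize_ne9_and_fadingMemory_of_couplingTwoPoint_vacSub_sizeInduction_compProj {ι : Type}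
    {E : Functional R.carriers Bg} (ρA ρB : (ℕ → ℝ) → R.carriers.BgB → R.carriers.Dom → ℂ)
    {W : Set (ℕ → ℝ)} {Adm MF : Set (Bg → R.carriers.Dom → ℝ)}
    {P : (Bg → R.carriers.Dom → ℝ) → (Bg → R.carriers.Dom → ℝ)} {𝒯 : ℕ → (ℕ → ℝ) → (Bg → R.carriers.Dom → ℝ) → ι → ℝ}
    {Ψ : ℕ → ℝ → (ι → ℝ) → Bg → R.carriers.Dom → ℝ}
    {act : ℕ → ℝ → Bg → Pot → (ClusterGeom.ofRep (clusterRep R ρA ρB)).P → ℂ} {𝒜 : ℕ → Set Pot}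
    {n : ℕ → ℝ → Bg → (ClusterGeom.ofRep (clusterRep R ρA ρB)).P → ℝ} {lip clip : ℕ → ℝ}
    {κ τ σ lipbar clipbar qTbar τbar ω c : ℝ} {wt : ℕ → ι → ℝ} {τm : ℕ → ℕ → ℝ} {qT p₀ N : ℕ → ℝ}
    (ρ : ℕ → (ι → ℝ) → Pot) (U₀ : Bg) (explZ : ℕ → Bg → R.carriers.Dom → ℝ)
    (h0 : ScaleZeroFree E W) (hAdm : AdmissibleTerms E W Adm) (hres : AdmRestrict Adm)
    -- the projection binders and the channel binders ON THE MARGINAL-FREE CLASS (owner's v1.3)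
    (hPadd : ProjAdditive Adm P) (hPcomm : ProjScaleComm Adm P) (hPinto : ProjInto Adm MF P) (hPsize : ProjSize Adm P κ c)
    (hc : 0 ≤ c) (hadd : ChannelAdditive MF 𝒯) (hsum : ChannelStepSum MF 𝒯) (hstep : ChannelSizeAtStepNN MF 𝒯 κ wt τm)
    (hfac : Factorises E W (compProj 𝒯 P) Ψ) (hclip0 : ∀ k, 0 ≤ clip k)
    (hCup : ∀ g ∈ W, ∀ g' ∈ W, ∀ (k : ℕ) (U : Bg) (X : R.carriers.Dom), R.carriers.scale X = k + 1 → ∀ Q ∈ 𝒜 k,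
      ∀ γ ∈ (ClusterGeom.ofRep (clusterRep R ρA ρB)).vol X,
        ‖act k (g k) U Q γ‖ ≤ n k (g' k) U γ ∧
          ‖act k (g k) U Q γ - act k (g' k) U Q γ‖ ≤ clip k * |g k - g' k| * n k (g' k) U γ)
    (hqT0 : ∀ k, 0 ≤ qT k)
    (hTcup : ∀ g ∈ W, ∀ g' ∈ W, ∀ (k : ℕ) (y : ι),
      |compProj 𝒯 P k g (E g) y - compProj 𝒯 P k g' (E g) y| ≤ wt k y * (qT k * |g k - g' k|))
    (hreprV : ∀ (k : ℕ) (s : ℝ) (Q : ι → ℝ) (U : Bg) (X : R.carriers.Dom),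
      Ψ k s Q U X = ((ClusterGeom.ofRep (clusterRep R ρA ρB)).newTerm act k s U X (ρ k Q)).re -
        ((ClusterGeom.ofRep (clusterRep R ρA ρB)).newTerm act k s U₀ X (ρ k Q)).re + explZ k U X)
    (hclipb : ∀ k, clip k ≤ clipbar) (hqTb : ∀ k, qT k ≤ qTbar)
    (hK : TwoPointKP (ClusterGeom.ofRep (clusterRep R ρA ρB)) W act 𝒜 n lip
      (fun Z => τ * ((footprint Z).card : ℝ)) (fun Z => σ * R.carriers.d Z + σ * 5))
    -- L-G1, L-G2 DISCHARGED in the printed currency: three scalars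
    (hτ : 0 ≤ τ) (hσ : 0 ≤ σ) (hσκ : κ + 1 ≤ σ)
    (hρ : ∀ (k : ℕ) (Q Q' : ι → ℝ) (M : ℝ), (∀ y, |Q y - Q' y| ≤ wt k y * M) → ‖ρ k Q - ρ k Q'‖ ≤ M)
    (hexplZ : ∀ (k : ℕ) (U : Bg) (X : R.carriers.Dom), R.carriers.scale X = k + 1 →
      |explZ k U X| ≤ Real.exp (-(κ * R.carriers.d X)) * p₀ k)
    (hbase : ∀ g ∈ W, ∀ (U : Bg) (X : R.carriers.Dom), R.carriers.scale X = 0 →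
      |E g U X| ≤ Real.exp (-(κ * R.carriers.d X)) * N 0)
    (hNsucc : ∀ j, p₀ j + 2 * (τ * 64 * Real.exp (-(σ * 5))) ≤ N (j + 1)) (hNnn : ∀ j, 0 ≤ N j)
    (hbox : ∀ (k : ℕ) (Q : ι → ℝ),
      (∀ y, |Q y| ≤ wt k y * sizeRadius (fun k j => (1 + c) * τm k j) N k) → ρ k Q ∈ 𝒜 k)
    (hlipb : ∀ k, lip k ≤ lipbar) (hτbar : 0 ≤ τbar) (hω : 0 ≤ ω)
    (hpos : 0 < ω + 8 * lipbar * (τ * 64 * Real.exp (-(σ * 5))) * ((1 + c) * τbar))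
    (hτm : ∀ k j, j ≤ k → 0 ≤ τm k j ∧ τm k j ≤ τbar * ω ^ (k - j)) :
    TermSize E W κ N ∧
      NE9 E W κ (prodModuli (8 * clipbar * (τ * 64 * Real.exp (-(σ * 5))) +
          8 * lipbar * (τ * 64 * Real.exp (-(σ * 5))) * qTbar)
        fun _ => ω + 8 * lipbar * (τ * 64 * Real.exp (-(σ * 5))) * ((1 + c) * τbar)) ∧
        FadingMemory ((8 * clipbar * (τ * 64 * Real.exp (-(σ * 5))) + 8 * lipbar * (τ * 64 * Real.exp (-(σ * 5))) * qTbar) /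
            (ω + 8 * lipbar * (τ * 64 * Real.exp (-(σ * 5))) * ((1 + c) * τbar)))
          (ω + 8 * lipbar * (τ * 64 * Real.exp (-(σ * 5))) * ((1 + c) * τbar))
          (prodModuli (8 * clipbar * (τ * 64 * Real.exp (-(σ * 5))) + 8 * lipbar * (τ * 64 * Real.exp (-(σ * 5))) * qTbar)
            fun _ => ω + 8 * lipbar * (τ * 64 * Real.exp (-(σ * 5))) * ((1 + c) * τbar)) :=
  ne9_and_fadingMemory_of_couplingTwoPoint_vacSub_sizeInduction_compProj (ClusterGeom.ofRep (clusterRep R ρA ρB)) ρ U₀ explZ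
    h0 hAdm hres hPadd hPcomm hPinto hPsize hc hadd hsum hstep hfac hclip0 hCup hqT0 hTcup hreprV hclipb hqTb hK
    (fun X K hK' => decayExtract_b13 ρA ρB hσ X K hK') (fun _ X _ => pinBudget_b13 ρA ρB hτ hσκ X) hρ hexplZ hbase hNsucc
    hNnn hbox (by positivity) hlipb hτbar hω hpos hτm

/-- **THE OWNER's READ-OUT FACE (`P := margProj r A`, c = cr·aA) ON THE CARRIERS OF RECORD, GEOMETRY LEAVES IN THE PRINTED
CURRENCY d_j (kernel; bookkeeping).** `NE9MarginalProjectionEnd.…_margProj` at the same `C`, `G`, `a`, `d`, `δ`, `B := τ·64·e^{−5σ}`.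
[folklore] -/
theorem recTR_termSize_ne9_and_fadingMemory_of_couplingTwoPoint_vacSub_sizeInduction_margProj {ι : Type}
    {E : Functional R.carriers Bg} (ρA ρB : (ℕ → ℝ) → R.carriers.BgB → R.carriers.Dom → ℂ)
    {W : Set (ℕ → ℝ)} {Adm MF : Set (Bg → R.carriers.Dom → ℝ)}
    {r : ℕ → (Bg → R.carriers.Dom → ℝ) → ℝ} {A : Bg → R.carriers.Dom → ℝ}
    {𝒯 : ℕ → (ℕ → ℝ) → (Bg → R.carriers.Dom → ℝ) → ι → ℝ} {Ψ : ℕ → ℝ → (ι → ℝ) → Bg → R.carriers.Dom → ℝ}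
    {act : ℕ → ℝ → Bg → Pot → (ClusterGeom.ofRep (clusterRep R ρA ρB)).P → ℂ} {𝒜 : ℕ → Set Pot}
    {n : ℕ → ℝ → Bg → (ClusterGeom.ofRep (clusterRep R ρA ρB)).P → ℝ} {lip clip : ℕ → ℝ}
    {κ τ σ lipbar clipbar qTbar τbar ω cr aA : ℝ} {wt : ℕ → ι → ℝ} {τm : ℕ → ℕ → ℝ} {qT p₀ N : ℕ → ℝ}
    (ρ : ℕ → (ι → ℝ) → Pot) (U₀ : Bg) (explZ : ℕ → Bg → R.carriers.Dom → ℝ)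
    (h0 : ScaleZeroFree E W) (hAdm : AdmissibleTerms E W Adm) (hres : AdmRestrict Adm)
    -- the read-out, the marginal direction, the marginal-free class (owner's v1.3)
    (hrA : ReadAdditive Adm r) (hr0 : ReadZero r) (hrs : ReadSize Adm r κ cr) (hA : DirSize A κ aA) (hcr : 0 ≤ cr)
    (haA : 0 ≤ aA) (hPinto : ProjInto Adm MF (margProj r A))
    (hadd : ChannelAdditive MF 𝒯) (hsum : ChannelStepSum MF 𝒯) (hstep : ChannelSizeAtStepNN MF 𝒯 κ wt τm)
    (hfac : Factorises E W (compProj 𝒯 (margProj r A)) Ψ) (hclip0 : ∀ k, 0 ≤ clip k)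
    (hCup : ∀ g ∈ W, ∀ g' ∈ W, ∀ (k : ℕ) (U : Bg) (X : R.carriers.Dom), R.carriers.scale X = k + 1 → ∀ Q ∈ 𝒜 k,
      ∀ γ ∈ (ClusterGeom.ofRep (clusterRep R ρA ρB)).vol X,
        ‖act k (g k) U Q γ‖ ≤ n k (g' k) U γ ∧
          ‖act k (g k) U Q γ - act k (g' k) U Q γ‖ ≤ clip k * |g k - g' k| * n k (g' k) U γ)
    (hqT0 : ∀ k, 0 ≤ qT k)
    (hTcup : ∀ g ∈ W, ∀ g' ∈ W, ∀ (k : ℕ) (y : ι),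
      |compProj 𝒯 (margProj r A) k g (E g) y - compProj 𝒯 (margProj r A) k g' (E g) y| ≤
        wt k y * (qT k * |g k - g' k|))
    (hreprV : ∀ (k : ℕ) (s : ℝ) (Q : ι → ℝ) (U : Bg) (X : R.carriers.Dom),
      Ψ k s Q U X = ((ClusterGeom.ofRep (clusterRep R ρA ρB)).newTerm act k s U X (ρ k Q)).re -
        ((ClusterGeom.ofRep (clusterRep R ρA ρB)).newTerm act k s U₀ X (ρ k Q)).re + explZ k U X)
    (hclipb : ∀ k, clip k ≤ clipbar) (hqTb : ∀ k, qT k ≤ qTbar)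
    (hK : TwoPointKP (ClusterGeom.ofRep (clusterRep R ρA ρB)) W act 𝒜 n lip
      (fun Z => τ * ((footprint Z).card : ℝ)) (fun Z => σ * R.carriers.d Z + σ * 5))
    -- L-G1, L-G2 DISCHARGED in the printed currency: three scalars
    (hτ : 0 ≤ τ) (hσ : 0 ≤ σ) (hσκ : κ + 1 ≤ σ)
    (hρ : ∀ (k : ℕ) (Q Q' : ι → ℝ) (M : ℝ), (∀ y, |Q y - Q' y| ≤ wt k y * M) → ‖ρ k Q - ρ k Q'‖ ≤ M)
    (hexplZ : ∀ (k : ℕ) (U : Bg) (X : R.carriers.Dom), R.carriers.scale X = k + 1 →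
      |explZ k U X| ≤ Real.exp (-(κ * R.carriers.d X)) * p₀ k)
    (hbase : ∀ g ∈ W, ∀ (U : Bg) (X : R.carriers.Dom), R.carriers.scale X = 0 →
      |E g U X| ≤ Real.exp (-(κ * R.carriers.d X)) * N 0)
    (hNsucc : ∀ j, p₀ j + 2 * (τ * 64 * Real.exp (-(σ * 5))) ≤ N (j + 1)) (hNnn : ∀ j, 0 ≤ N j)
    (hbox : ∀ (k : ℕ) (Q : ι → ℝ),
      (∀ y, |Q y| ≤ wt k y * sizeRadius (fun k j => (1 + cr * aA) * τm k j) N k) → ρ k Q ∈ 𝒜 k)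
    (hlipb : ∀ k, lip k ≤ lipbar) (hτbar : 0 ≤ τbar) (hω : 0 ≤ ω)
    (hpos : 0 < ω + 8 * lipbar * (τ * 64 * Real.exp (-(σ * 5))) * ((1 + cr * aA) * τbar))
    (hτm : ∀ k j, j ≤ k → 0 ≤ τm k j ∧ τm k j ≤ τbar * ω ^ (k - j)) :
    TermSize E W κ N ∧
      NE9 E W κ (prodModuli (8 * clipbar * (τ * 64 * Real.exp (-(σ * 5))) +
          8 * lipbar * (τ * 64 * Real.exp (-(σ * 5))) * qTbar)
        fun _ => ω + 8 * lipbar * (τ * 64 * Real.exp (-(σ * 5))) * ((1 + cr * aA) * τbar)) ∧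
        FadingMemory ((8 * clipbar * (τ * 64 * Real.exp (-(σ * 5))) + 8 * lipbar * (τ * 64 * Real.exp (-(σ * 5))) * qTbar) /
            (ω + 8 * lipbar * (τ * 64 * Real.exp (-(σ * 5))) * ((1 + cr * aA) * τbar)))
          (ω + 8 * lipbar * (τ * 64 * Real.exp (-(σ * 5))) * ((1 + cr * aA) * τbar))
          (prodModuli (8 * clipbar * (τ * 64 * Real.exp (-(σ * 5))) + 8 * lipbar * (τ * 64 * Real.exp (-(σ * 5))) * qTbar)
            fun _ => ω + 8 * lipbar * (τ * 64 * Real.exp (-(σ * 5))) * ((1 + cr * aA) * τbar)) :=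
  ne9_and_fadingMemory_of_couplingTwoPoint_vacSub_sizeInduction_margProj (ClusterGeom.ofRep (clusterRep R ρA ρB)) ρ U₀ explZ
    h0 hAdm hres hrA hr0 hrs hA hcr haA hPinto hadd hsum hstep hfac hclip0 hCup hqT0 hTcup hreprV hclipb hqTb hK
    (fun X K hK' => decayExtract_b13 ρA ρB hσ X K hK') (fun _ X _ => pinBudget_b13 ρA ρB hτ hσκ X) hρ hexplZ hbase hNsucc
    hNnn hbox (by positivity) hlipb hτbar hω hpos hτm

omit [NormedSpace ℂ Pot] in
/-- **THE A1-KP CONJUNCT IN THE PRINTED CURRENCY (kernel; bookkeeping).**  On the carriers of record with `Bg := R.carriers.BgB`,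
NE5-P2's `KPInflated (clusterRep R ρA ρB) W m 1 a d` with the majorant read through the creation step of the polymer
(`m g U Z := n (scale Z − 1) (g (scale Z − 1)) U Z`; inflation `s = 1` = the factor `2` of `TwoPointKP`) — the conclusion shape of the
d-currency producer `B13DomainGeometryTR.kpInflated_b13` (ADDITIVE room `64·log 162 + σ + 64τ ≤ R`) — together with the two
activity-level clauses (size, two-point in the table) and `0 ≤ lip k` IS `TwoPointKP` on `ClusterGeom.ofRep (clusterRep R ρA ρB)`
(cross-row probe C-ne9leaf09-2 made a lemma).  So all three geometry∕entropy binders of END-B (A1-KP, G1, G2) have printed-currency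
producers on the carriers of record; the (2.38)-shaped majorant itself stays NODE O's. [folklore] -/
theorem twoPointKP_of_kpInflated (ρA ρB : (ℕ → ℝ) → R.carriers.BgB → R.carriers.Dom → ℂ) {W : Set (ℕ → ℝ)}
    {act : ℕ → ℝ → R.carriers.BgB → Pot → (ClusterGeom.ofRep (clusterRep R ρA ρB)).P → ℂ} {𝒜 : ℕ → Set Pot}
    {n : ℕ → ℝ → R.carriers.BgB → (ClusterGeom.ofRep (clusterRep R ρA ρB)).P → ℝ} {lip : ℕ → ℝ}
    {a d : (ClusterGeom.ofRep (clusterRep R ρA ρB)).P → ℝ} (hlip : ∀ k, 0 ≤ lip k)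
    (hsize : ∀ g ∈ W, ∀ (k : ℕ) (U : R.carriers.BgB) (X : R.carriers.Dom), R.carriers.scale X = k + 1 → ∀ Q ∈ 𝒜 k,
      ∀ γ ∈ (ClusterGeom.ofRep (clusterRep R ρA ρB)).vol X, ‖act k (g k) U Q γ‖ ≤ n k (g k) U γ)
    (htwo : ∀ g ∈ W, ∀ (k : ℕ) (U : R.carriers.BgB) (X : R.carriers.Dom), R.carriers.scale X = k + 1 → ∀ Q ∈ 𝒜 k,
      ∀ Q' ∈ 𝒜 k, ∀ γ ∈ (ClusterGeom.ofRep (clusterRep R ρA ρB)).vol X,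
        ‖act k (g k) U Q γ - act k (g k) U Q' γ‖ ≤ lip k * ‖Q - Q'‖ * n k (g k) U γ)
    (hKP : T4ActivityRecursion.KPInflated (clusterRep R ρA ρB) W
      (fun g U Z => n (R.carriers.scale Z - 1) (g (R.carriers.scale Z - 1)) U Z) 1 a d) :
    TwoPointKP (ClusterGeom.ofRep (clusterRep R ρA ρB)) W act 𝒜 n lip a d := by
  refine ⟨hKP.1, hKP.2.1, hlip, fun g hg k U X hX => ⟨hsize g hg k U X hX, htwo g hg k U X hX, ?_⟩⟩
  intro γ hγ
  have h := hKP.2.2 g hg U X γ hγ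
  refine le_of_eq_of_le (Finset.sum_congr rfl fun γ' hγ' => ?_) h
  have hmem : γ' ∈ (B13DomainGeometryTR.domainGeometry R).level (R.carriers.scale X) := (Finset.mem_filter.1 hγ').1
  have hsc : R.carriers.scale γ' = k + 1 :=
    hX ▸ ((B13DomainGeometryTR.domainGeometry R).mem_level γ' _).1 hmem
  show 2 * n k (g k) U γ' * _ = (1 + 1) * n (R.carriers.scale γ' - 1) (g (R.carriers.scale γ' - 1)) U γ' * _
  rw [hsc, Nat.add_sub_cancel]; norm_num

end Summit.QuantumFields.BalabanUV.T4Continuum.NE9.CarriersOfRecordFacesTR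

end
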